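import Literature.Geometry.Kaehler.ComplexTorusMixedHodgeRiemannPZero
import Literature.Geometry.Kaehler.ComplexTorusMixedHodgeIndexDegreeTwo
import HarnessLib

/-!
# The mixed hard Lefschetz theorem on `H^{p,0}(X) ⊕ H^{0,p}(X)` for every `p`, and in degree one, on a
# complex torus: `B ↦ ω_1 ∧ ⋯ ∧ ω_n ∧ B` is a bijection `Λ^{p,0} ⥲ Λ^{n+p, n}`, `Λ^{0,p} ⥲ Λ^{n, n+p}` and
# `H¹(X, ℂ) ⥲ H^{2n+1}(X, ℂ)` (Dinh–Nguyên 2006, Prop. 2.1 (a) with `q = 0` / `p = 0`, Thm. B for `k = 1`)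

Layer `Literature/Geometry/Kaehler`, namespace `Literature.Geometry.Kaehler.ComplexTorus`; lane `lit-hodgefound`
(Track 2 foundations library, Layer A: Hodge theory of complex tori on invariant forms), seat p16, generation 23
(row g23-#3). Sequel of `ComplexTorusMixedHodgeRiemannPZero` (row g23-#2: the mixed Hodge–Riemann relation
`(-1)^{C(p,2)} iᵖ ∫_X Ω ∧ B ∧ B̄ > 0` for `0 ≠ B ∈ H^{p,0}(X)` and its `(0,p)` companion) and of
`ComplexTorusMixedHardLefschetzDegreeTwo` (row g23-#1: the operator `A ↦ Ω ∧ A` on `H²`). Hodge–Riemann gives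
hard Lefschetz: if `Ω ∧ B = 0` then `Ω ∧ B ∧ B̄ = 0`, so `B = 0`; on `H^{p,0} ⊕ H^{0,p}` the two pieces of
`Ω ∧ B` have different types, and in degree one `H¹ = H^{1,0} ⊕ H^{0,1}` is the whole space. THEOREMS ONLY: no
definition, no named fact (net debt 0).

## Sources (verbatim, held copies)

* T.-C. Dinh, V.-A. Nguyên, *The mixed Hodge–Riemann bilinear relations for compact Kähler manifolds*, GAFA 16
  (2006) 838–849 [DinhNguyen2006] (held `paper:arxiv-math_0501449`), p. 5 (p0005 L15–L31), **Proposition 2.1**: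
  "`ω_1, …, ω_{n-p-q+1}` strictly positive forms of `Λ^{1,1}(ℂⁿ)` […] `Ω := ω_1 ∧ ⋯ ∧ ω_{n-p-q}`. […] (a) The
  operator of multiplication by `Ω` induces an isomorphism between `Λ^{p,q}(ℂⁿ)` and `Λ^{n-q,n-p}(ℂⁿ)`." — here
  `q = 0` (and `p = 0`): `Ω ∧ · : Λ^{p,0} ⥲ Λ^{n', n'-p}`, `n' = dim`; p. 4, **Theorem B** (mixed hard Lefschetz:
  `[α] ↦ [α] ∧ [Ω]` is an isomorphism `H^{p,q} ⥲ H^{n-q,n-p}`), here for `k = p + q = 1` on a torus; p. 3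
  **Theorem 1.3** (Timorin's theorem) — the input, through `ComplexTorusMixedHodgeRiemannPZero`.
* V. A. Timorin, *Mixed Hodge–Riemann bilinear relations in a linear context*, Funct. Anal. Appl. 32 (1998)
  268–272 [Timorin1998], Proposition 1 / Main Theorem / Corollary 2.
* D. Huybrechts, *Complex Geometry* (2005) [Huybrechts2005], Prop. 3.3.13 (hard Lefschetz) — the unmixed statement;
  C. Voisin, *Hodge Theory and Complex Algebraic Geometry I* (2002) [VoisinHodgeI2002], §6.2.3 Thm. 6.25, §2.3.1
  (types add under `∧`; the type decomposition `Λᵏ = ⊕ Λ^{p,q}`); H. Lange, *Abelian Varieties over the Complex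
  Numbers* (2023) [Lange2023AbelianVarietiesComplex], §1.1.3 Cor. 1.1.19 (`dim H^k = C(2g, k)`), §1.1.5 Prop. 1.1.23
  (`dim H^{p,q} = C(g,p) C(g,q)`), §5.1.2; F. Warner [WarnerGTM94], 2.6 (`∧` associative).

## What is proved

`X = E/Φ(ℤ^ι)` a complex torus of dimension `n + p` (`e : Fin (2(n+p)) ≃ ι`), `θ_1, …, θ_n` positive real
`(1,1)`-forms (`ω_m = -θ_m`), `Ω = wedgeFamily n ((-θ_m)_ℂ)_m = ω_1 ∧ ⋯ ∧ ω_n`.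

1. `wedge_wedge_eq_zero_of_wedge_eq_zero`: `Ω ∧ B = 0 ⇒ Ω ∧ (B ∧ C) = 0` (associativity).
2. **Hard Lefschetz on `H^{p,0}` and on `H^{0,p}`**: `Ω ∧ B = 0 ⇒ B = 0` for `B ∈ Λ^{p,0}`
   (`eq_zero_of_wedgeFamily_wedge_eq_zero_of_mem_pZero`, from `torusIntegral_pZero_pos_of_pos`) and for `B ∈ Λ^{0,p}`
   (`…_of_mem_zeroP`); **and on `H^{p,0} ⊕ H^{0,p}`** for `p ≠ 0` (`…_of_mem_sup`: the two pieces of `Ω ∧ B` have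
   the different types `(n+p, n)`, `(n, n+p)`).
3. **Prop. 2.1 (a), `q = 0` and `p = 0`**: `B ↦ Ω ∧ B` is a bijection `Λ^{p,0} ⥲ Λ^{n+p, n}` and
   `Λ^{0,p} ⥲ Λ^{n, n+p}` (`wedgeFamily_wedge_bijective_pZero/_zeroP`; `dim = C(n+p, p)` on both sides).
4. **Theorem B for `k = 1` on a torus (mixed hard Lefschetz in degree one)**: on `X` of dimension `n + 1`,
   `α ↦ ω_1 ∧ ⋯ ∧ ω_n ∧ α` is injective on `H¹(X, ℂ) = H^{1,0} ⊕ H^{0,1}` and a bijection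
   `H¹(X, ℂ) ⥲ H^{2n+1}(X, ℂ)` (`wedgeFamily_wedge_bijective_degreeOne`; `C(2n+2, 1) = C(2n+2, 2n+1)`); real classes:
   `Ω ∧ α_ℂ = 0 ⇒ α = 0`.
5. `IsRiemannForm.` readings (`Ω = c₁(L_1) ∧ ⋯ ∧ c₁(L_n)`).

NOT claimed: `H^{p,q}` with `p, q ≥ 1` and `p + q ≥ 3` (there mixed primitivity is a genuine condition and
Theorem B needs the full Hodge–Riemann package), manifolds other than tori, semi-positive backgrounds.
-/

noncomputable section

open scoped ComplexConjugate ComplexOrder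
open Complex Function Module Finset
open Literature.LinearAlgebra.Alternating
open Literature.Analysis.Complex (IsOfTypeAt typeSubmodule isOfTypeAt_of_mem_typeSubmodule finrank_typeSubmodule
  finrank_alt_real_complex typeProjAt sum_antidiagonal_typeProjAt isOfTypeAt_typeProjAt typeProjAt_add
  typeProjAt_zero)

namespace Literature.Geometry.Kaehler

namespace ComplexTorus

/-! ## §1 `Ω ∧ B = 0 ⇒ Ω ∧ B ∧ C = 0`; hard Lefschetz on `H^{p,0}` and `H^{0,p}` from Hodge–Riemann -/

section PZero

variable {E : Type*} [NormedAddCommGroup E] [NormedSpace ℂ E]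

/-- **`Ω ∧ B = 0` forces `Ω ∧ (B ∧ C) = 0`** (`∧` is associative: `Ω ∧ (B ∧ C) = (Ω ∧ B) ∧ C` in the ring of graded
forms). [cite: WarnerGTM94, 2.6] -/
theorem wedge_wedge_eq_zero_of_wedge_eq_zero {a b c : ℕ} {Ω : E [⋀^Fin a]→L[ℝ] ℂ} {B : E [⋀^Fin b]→L[ℝ] ℂ}
    (h : Ω.wedge B = 0) (C : E [⋀^Fin c]→L[ℝ] ℂ) : Ω.wedge (B.wedge C) = 0 :=
  GForm.of_injective (a + (b + c)) (by
    rw [← GForm.of_mul_of, ← GForm.of_mul_of, ← mul_assoc, GForm.of_mul_of a b, h, GForm.of_zero, zero_mul,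
      GForm.of_zero])

variable {ι : Type*} [Fintype ι] [DecidableEq ι] (Φ : (ι → ℝ) ≃L[ℝ] E)

include Φ in
/-- **Mixed hard Lefschetz on `H^{p,0}(X)`**: for positive `(1,1)`-forms `θ_1, …, θ_n` on a complex torus of dimension
`n + p` (`Ω = ω_1 ∧ ⋯ ∧ ω_n`, `ω_m = -θ_m`) and `B ∈ H^{p,0}(X)`, **`Ω ∧ B = 0 ⇒ B = 0`** — by the mixed Hodge–Riemann
relation `(-1)^{C(p,2)} iᵖ ∫_X Ω ∧ B ∧ B̄ > 0` for `B ≠ 0`. [cite: DinhNguyen2006, §2 Prop. 2.1 (a), (b) (arXiv PDF p. 5)]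
[cite: Timorin1998, Main Theorem] -/
theorem eq_zero_of_wedgeFamily_wedge_eq_zero_of_mem_pZero {n p : ℕ} (e : Fin (2 * (n + p)) ≃ ι)
    {θ : Fin n → E [⋀^Fin 2]→L[ℝ] ℝ} (h11 : ∀ m (x y : E), θ m ![I • x, I • y] = θ m ![x, y])
    (hpos : ∀ m (v : E), v ≠ 0 → 0 < θ m ![I • v, v]) {B : E [⋀^Fin p]→L[ℝ] ℂ}
    (hB : B ∈ typeSubmodule E p p 0) (h : (wedgeFamily n fun m ↦ ofRealForm (-(θ m))).wedge B = 0) : B = 0 := by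
  by_contra hB0
  have hpos' := torusIntegral_pZero_pos_of_pos Φ e θ h11 hpos hB hB0 (by ring)
  rw [wedge_wedge_eq_zero_of_wedge_eq_zero h (conjForm B), Literature.LinearAlgebra.Alternating.domDomCongr_finCongr_zero,
    torusIntegral_zero, mul_zero] at hpos'
  exact lt_irrefl _ hpos'

include Φ in
/-- **Mixed hard Lefschetz on `H^{0,p}(X)`**: `Ω ∧ B = 0 ⇒ B = 0` for `B ∈ H^{0,p}(X)` (the `(0,p)` Hodge–Riemann relation).
[cite: DinhNguyen2006, §2 Prop. 2.1 (a), (b) (arXiv PDF p. 5)] [cite: Timorin1998, Main Theorem] -/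
theorem eq_zero_of_wedgeFamily_wedge_eq_zero_of_mem_zeroP {n p : ℕ} (e : Fin (2 * (n + p)) ≃ ι)
    {θ : Fin n → E [⋀^Fin 2]→L[ℝ] ℝ} (h11 : ∀ m (x y : E), θ m ![I • x, I • y] = θ m ![x, y])
    (hpos : ∀ m (v : E), v ≠ 0 → 0 < θ m ![I • v, v]) {B : E [⋀^Fin p]→L[ℝ] ℂ}
    (hB : B ∈ typeSubmodule E p 0 p) (h : (wedgeFamily n fun m ↦ ofRealForm (-(θ m))).wedge B = 0) : B = 0 := by
  by_contra hB0
  have hpos' := torusIntegral_zeroP_pos_of_pos Φ e θ h11 hpos hB hB0 (by ring)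
  rw [wedge_wedge_eq_zero_of_wedge_eq_zero h (conjForm B), Literature.LinearAlgebra.Alternating.domDomCongr_finCongr_zero,
    torusIntegral_zero, mul_zero] at hpos'
  exact lt_irrefl _ hpos'

omit [Fintype ι] [DecidableEq ι] in
/-- A negated real `(1,1)` background complexifies to a `(1,1)` family. [folklore] -/
private theorem isOfTypeAt_background' {n : ℕ} {θ : Fin n → E [⋀^Fin 2]→L[ℝ] ℝ}
    (h11 : ∀ m (x y : E), θ m ![I • x, I • y] = θ m ![x, y]) (m : Fin n) :
    IsOfTypeAt 1 1 (ofRealForm (-(θ m))) :=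
  isOfTypeAt_one_one_ofRealForm fun x y ↦ by
    rw [ContinuousAlternatingMap.neg_apply, ContinuousAlternatingMap.neg_apply, h11]

include Φ in
/-- **Mixed hard Lefschetz on `H^{p,0}(X) ⊕ H^{0,p}(X)`** (`p ≠ 0`): `Ω ∧ (B₁ + B₂) = 0` with `B₁ ∈ Λ^{p,0}`,
`B₂ ∈ Λ^{0,p}` forces `B₁ = B₂ = 0` — `Ω ∧ B₁` has type `(n+p, n)` and `Ω ∧ B₂` type `(n, n+p)`, so each vanishes.
[cite: DinhNguyen2006, §2 Prop. 2.1 (a) (arXiv PDF p. 5)] [cite: VoisinHodgeI2002, §2.3.1] -/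
theorem eq_zero_of_wedgeFamily_wedge_add_eq_zero {n p : ℕ} (e : Fin (2 * (n + p)) ≃ ι) (hp : p ≠ 0)
    {θ : Fin n → E [⋀^Fin 2]→L[ℝ] ℝ} (h11 : ∀ m (x y : E), θ m ![I • x, I • y] = θ m ![x, y])
    (hpos : ∀ m (v : E), v ≠ 0 → 0 < θ m ![I • v, v]) {B₁ B₂ : E [⋀^Fin p]→L[ℝ] ℂ}
    (hB₁ : B₁ ∈ typeSubmodule E p p 0) (hB₂ : B₂ ∈ typeSubmodule E p 0 p)
    (h : (wedgeFamily n fun m ↦ ofRealForm (-(θ m))).wedge (B₁ + B₂) = 0) : B₁ = 0 ∧ B₂ = 0 := by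
  set Ω := wedgeFamily n fun m ↦ ofRealForm (-(θ m)) with hΩ
  have hΩt : IsOfTypeAt n n Ω := isOfTypeAt_wedgeFamily (isOfTypeAt_background' h11)
  have h₁ : IsOfTypeAt (n + p) (n + 0) (Ω.wedge B₁) := hΩt.wedge (isOfTypeAt_of_mem_typeSubmodule rfl hB₁)
  have h₂ : IsOfTypeAt (n + 0) (n + p) (Ω.wedge B₂) := hΩt.wedge (isOfTypeAt_of_mem_typeSubmodule (zero_add p) hB₂)
  rw [ContinuousAlternatingMap.wedge_add_right] at h
  have hproj₁ := congrArg (typeProjAt (n + p) (n + 0)) h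
  rw [typeProjAt_add, h₁.typeProjAt_eq_self, h₂.typeProjAt_of_ne (Or.inl (by omega)), add_zero, typeProjAt_zero]
    at hproj₁
  have hproj₂ := congrArg (typeProjAt (n + 0) (n + p)) h
  rw [typeProjAt_add, h₂.typeProjAt_eq_self, h₁.typeProjAt_of_ne (Or.inl (by omega)), zero_add, typeProjAt_zero]
    at hproj₂
  exact ⟨eq_zero_of_wedgeFamily_wedge_eq_zero_of_mem_pZero Φ e h11 hpos hB₁ hproj₁,
    eq_zero_of_wedgeFamily_wedge_eq_zero_of_mem_zeroP Φ e h11 hpos hB₂ hproj₂⟩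

include Φ in
/-- **`Ω ∧ ·` is injective on `H^{p,0}(X) ⊕ H^{0,p}(X)`** (`p ≠ 0`).
[cite: DinhNguyen2006, §2 Prop. 2.1 (a) (arXiv PDF p. 5)] [cite: VoisinHodgeI2002, §2.3.1] -/
theorem eq_zero_of_wedgeFamily_wedge_eq_zero_of_mem_sup {n p : ℕ} (e : Fin (2 * (n + p)) ≃ ι) (hp : p ≠ 0)
    {θ : Fin n → E [⋀^Fin 2]→L[ℝ] ℝ} (h11 : ∀ m (x y : E), θ m ![I • x, I • y] = θ m ![x, y])
    (hpos : ∀ m (v : E), v ≠ 0 → 0 < θ m ![I • v, v]) {B : E [⋀^Fin p]→L[ℝ] ℂ}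
    (hB : B ∈ typeSubmodule E p p 0 ⊔ typeSubmodule E p 0 p)
    (h : (wedgeFamily n fun m ↦ ofRealForm (-(θ m))).wedge B = 0) : B = 0 := by
  obtain ⟨B₁, hB₁, B₂, hB₂, rfl⟩ := Submodule.mem_sup.1 hB
  obtain ⟨h1, h2⟩ := eq_zero_of_wedgeFamily_wedge_add_eq_zero Φ e hp h11 hpos hB₁ hB₂ h
  rw [h1, h2, add_zero]

end PZero

/-! ## §2 Prop. 2.1 (a) with `q = 0` / `p = 0`: `Ω ∧ · : Λ^{p,0} ⥲ Λ^{n+p, n}` and `Λ^{0,p} ⥲ Λ^{n, n+p}` -/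

section Bijective

variable {ι : Type*} [Fintype ι] [DecidableEq ι] {E : Type*} [NormedAddCommGroup E] [NormedSpace ℂ E]
  (Φ : (ι → ℝ) ≃L[ℝ] E)

omit [Fintype ι] [DecidableEq ι] in
/-- **Types add: `Ω ∧ Λ^{p,q} ⊆ Λ^{n+p, n+q}`** in every degree (background of length `n`).
[cite: VoisinHodgeI2002, §2.3.1] [cite: DinhNguyen2006, §2 Prop. 2.1 (a) (arXiv PDF p. 5)] -/
theorem wedgeFamily_wedge_mem_typeSubmodule' {n k p q : ℕ} {θ : Fin n → E [⋀^Fin 2]→L[ℝ] ℝ}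
    (h11 : ∀ m (x y : E), θ m ![I • x, I • y] = θ m ![x, y]) {B : E [⋀^Fin k]→L[ℝ] ℂ} (hpq : p + q = k)
    (hB : B ∈ typeSubmodule E k p q) :
    (wedgeFamily n fun m ↦ ofRealForm (-(θ m))).wedge B ∈ typeSubmodule E (2 * n + k) (n + p) (n + q) :=
  ((isOfTypeAt_wedgeFamily (isOfTypeAt_background' h11)).wedge (isOfTypeAt_of_mem_typeSubmodule hpq hB)).mem_typeSubmodule

include Φ in
omit [DecidableEq ι] in
/-- **`dim_ℂ Λ^{n+p, n} = dim_ℂ Λ^{p,0} = C(g, p)`** on a torus of dimension `g = n + p` (`C(g, g) = 1`, `C(g, n) = C(g, p)`).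
[cite: Lange2023AbelianVarietiesComplex, §1.1.5 Prop. 1.1.23] -/
theorem finrank_typeSubmodule_pZero_shift_eq [FiniteDimensional ℂ E] {n p : ℕ} (e : Fin (2 * (n + p)) ≃ ι) :
    finrank ℂ (typeSubmodule E (2 * n + p) (n + p) (n + 0)) = finrank ℂ (typeSubmodule E p p 0) := by
  have hg : finrank ℂ E = n + p := finrank_eq_of_finTwoMulEquiv Φ e
  rw [finrank_typeSubmodule (k := 2 * n + p) (p := n + p) (q := n + 0) (by omega),
    finrank_typeSubmodule (k := p) (p := p) (q := 0) rfl, hg, Nat.choose_self, Nat.choose_zero_right, add_zero,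
    one_mul, mul_one]
  exact Nat.choose_symm_of_eq_add rfl

include Φ in
omit [DecidableEq ι] in
/-- **`dim_ℂ Λ^{n, n+p} = dim_ℂ Λ^{0,p} = C(g, p)`** on a torus of dimension `g = n + p`.
[cite: Lange2023AbelianVarietiesComplex, §1.1.5 Prop. 1.1.23] -/
theorem finrank_typeSubmodule_zeroP_shift_eq [FiniteDimensional ℂ E] {n p : ℕ} (e : Fin (2 * (n + p)) ≃ ι) :
    finrank ℂ (typeSubmodule E (2 * n + p) (n + 0) (n + p)) = finrank ℂ (typeSubmodule E p 0 p) := by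
  have hg : finrank ℂ E = n + p := finrank_eq_of_finTwoMulEquiv Φ e
  rw [finrank_typeSubmodule (k := 2 * n + p) (p := n + 0) (q := n + p) (by omega),
    finrank_typeSubmodule (k := p) (p := 0) (q := p) (zero_add p), hg, Nat.choose_self, Nat.choose_zero_right, add_zero,
    one_mul, mul_one]
  exact Nat.choose_symm_of_eq_add rfl

include Φ in
/-- **Dinh–Nguyên Prop. 2.1 (a) with `q = 0` on a complex torus: `B ↦ Ω ∧ B` is a bijection
`H^{p,0}(X) = Λ^{p,0} ⥲ Λ^{n+p, n} = Λ^{g, g-p}`** ("The operator of multiplication by `Ω` induces an isomorphism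
between `Λ^{p,q}(ℂⁿ)` and `Λ^{n-q,n-p}(ℂⁿ)`", `q = 0`, `dim = n + p`, `Ω = ω_1 ∧ ⋯ ∧ ω_n` positive): injective by
Hodge–Riemann, of equal dimensions `C(g, p)`. [cite: DinhNguyen2006, §2 Prop. 2.1 (a) (arXiv PDF p. 5)]
[cite: Timorin1998, Proposition 1] [cite: Lange2023AbelianVarietiesComplex, §1.1.5 Prop. 1.1.23] -/
theorem wedgeFamily_wedge_bijective_pZero {n p : ℕ} (e : Fin (2 * (n + p)) ≃ ι)
    {θ : Fin n → E [⋀^Fin 2]→L[ℝ] ℝ} (h11 : ∀ m (x y : E), θ m ![I • x, I • y] = θ m ![x, y])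
    (hpos : ∀ m (v : E), v ≠ 0 → 0 < θ m ![I • v, v]) :
    Function.Bijective fun B : typeSubmodule E p p 0 ↦
      (⟨(wedgeFamily n fun m ↦ ofRealForm (-(θ m))).wedge B,
        wedgeFamily_wedge_mem_typeSubmodule' h11 rfl B.2⟩ : typeSubmodule E (2 * n + p) (n + p) (n + 0)) := by
  haveI := finiteDimensional_complex Φ
  haveI := finiteDimensional_complexForms Φ e (k := p) (by omega)
  haveI := finiteDimensional_complexForms Φ e (k := 2 * n + p) (by omega)
  set L : (E [⋀^Fin p]→L[ℝ] ℂ) →ₗ[ℂ] (E [⋀^Fin (2 * n + p)]→L[ℝ] ℂ) :=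
    { toFun := fun B ↦ (wedgeFamily n fun m ↦ ofRealForm (-(θ m))).wedge B
      map_add' := fun A B ↦ ContinuousAlternatingMap.wedge_add_right _ _ _
      map_smul' := fun c A ↦ wedge_smul_right_complex c _ _ } with hL
  set L' : typeSubmodule E p p 0 →ₗ[ℂ] typeSubmodule E (2 * n + p) (n + p) (n + 0) :=
    L.restrict (p := typeSubmodule E p p 0) (q := typeSubmodule E (2 * n + p) (n + p) (n + 0))
      fun B hB ↦ wedgeFamily_wedge_mem_typeSubmodule' h11 rfl hB with hL'
  have hinj : Function.Injective L' := by
    intro A B h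
    apply Subtype.ext
    have h' : L ((A : E [⋀^Fin p]→L[ℝ] ℂ) - (B : E [⋀^Fin p]→L[ℝ] ℂ)) = 0 := by
      rw [map_sub]
      exact sub_eq_zero.2 (congrArg Subtype.val h)
    exact sub_eq_zero.1 (eq_zero_of_wedgeFamily_wedge_eq_zero_of_mem_pZero Φ e h11 hpos
      ((typeSubmodule E p p 0).sub_mem A.2 B.2) h')
  have H : finrank ℂ (typeSubmodule E p p 0) = finrank ℂ (typeSubmodule E (2 * n + p) (n + p) (n + 0)) :=
    (finrank_typeSubmodule_pZero_shift_eq Φ e).symm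
  have hsurj : Function.Surjective L' :=
    (LinearMap.injective_iff_surjective_of_finrank_eq_finrank (K := ℂ) (V := typeSubmodule E p p 0)
      (V₂ := typeSubmodule E (2 * n + p) (n + p) (n + 0)) H (f := L')).1 hinj
  exact ⟨hinj, hsurj⟩

include Φ in
/-- **Prop. 2.1 (a) with `p = 0`: `B ↦ Ω ∧ B` is a bijection `H^{0,p}(X) = Λ^{0,p} ⥲ Λ^{n, n+p} = Λ^{g-p, g}`.**
[cite: DinhNguyen2006, §2 Prop. 2.1 (a) (arXiv PDF p. 5)] [cite: Lange2023AbelianVarietiesComplex, §1.1.5 Prop. 1.1.23] -/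
theorem wedgeFamily_wedge_bijective_zeroP {n p : ℕ} (e : Fin (2 * (n + p)) ≃ ι)
    {θ : Fin n → E [⋀^Fin 2]→L[ℝ] ℝ} (h11 : ∀ m (x y : E), θ m ![I • x, I • y] = θ m ![x, y])
    (hpos : ∀ m (v : E), v ≠ 0 → 0 < θ m ![I • v, v]) :
    Function.Bijective fun B : typeSubmodule E p 0 p ↦
      (⟨(wedgeFamily n fun m ↦ ofRealForm (-(θ m))).wedge B,
        wedgeFamily_wedge_mem_typeSubmodule' h11 (zero_add p) B.2⟩ : typeSubmodule E (2 * n + p) (n + 0) (n + p)) := by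
  haveI := finiteDimensional_complex Φ
  haveI := finiteDimensional_complexForms Φ e (k := p) (by omega)
  haveI := finiteDimensional_complexForms Φ e (k := 2 * n + p) (by omega)
  set L : (E [⋀^Fin p]→L[ℝ] ℂ) →ₗ[ℂ] (E [⋀^Fin (2 * n + p)]→L[ℝ] ℂ) :=
    { toFun := fun B ↦ (wedgeFamily n fun m ↦ ofRealForm (-(θ m))).wedge B
      map_add' := fun A B ↦ ContinuousAlternatingMap.wedge_add_right _ _ _
      map_smul' := fun c A ↦ wedge_smul_right_complex c _ _ } with hL
  set L' : typeSubmodule E p 0 p →ₗ[ℂ] typeSubmodule E (2 * n + p) (n + 0) (n + p) :=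
    L.restrict (p := typeSubmodule E p 0 p) (q := typeSubmodule E (2 * n + p) (n + 0) (n + p))
      fun B hB ↦ wedgeFamily_wedge_mem_typeSubmodule' h11 (zero_add p) hB with hL'
  have hinj : Function.Injective L' := by
    intro A B h
    apply Subtype.ext
    have h' : L ((A : E [⋀^Fin p]→L[ℝ] ℂ) - (B : E [⋀^Fin p]→L[ℝ] ℂ)) = 0 := by
      rw [map_sub]
      exact sub_eq_zero.2 (congrArg Subtype.val h)
    exact sub_eq_zero.1 (eq_zero_of_wedgeFamily_wedge_eq_zero_of_mem_zeroP Φ e h11 hpos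
      ((typeSubmodule E p 0 p).sub_mem A.2 B.2) h')
  have H : finrank ℂ (typeSubmodule E p 0 p) = finrank ℂ (typeSubmodule E (2 * n + p) (n + 0) (n + p)) :=
    (finrank_typeSubmodule_zeroP_shift_eq Φ e).symm
  have hsurj : Function.Surjective L' :=
    (LinearMap.injective_iff_surjective_of_finrank_eq_finrank (K := ℂ) (V := typeSubmodule E p 0 p)
      (V₂ := typeSubmodule E (2 * n + p) (n + 0) (n + p)) H (f := L')).1 hinj
  exact ⟨hinj, hsurj⟩

end Bijective

/-! ## §3 Theorem B for `k = 1` on a torus: `α ↦ ω_1 ∧ ⋯ ∧ ω_n ∧ α` is a bijection `H¹(X, ℂ) ⥲ H^{2n+1}(X, ℂ)` -/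

section DegreeOne

variable {ι : Type*} [Fintype ι] [DecidableEq ι] {E : Type*} [NormedAddCommGroup E] [NormedSpace ℂ E]
  (Φ : (ι → ℝ) ≃L[ℝ] E)

/-- **`H¹(X, ℂ) = H^{1,0}(X) ⊕ H^{0,1}(X)`**: every complex `1`-form is the sum of its `(1,0)` and `(0,1)` parts.
[cite: VoisinHodgeI2002, §2.3.1] [cite: Lange2023AbelianVarietiesComplex, §1.1.5 Thm. 1.1.21] -/
theorem mem_typeSubmodule_oneZero_sup_zeroOne (α : E [⋀^Fin 1]→L[ℝ] ℂ) :
    α ∈ typeSubmodule E 1 1 0 ⊔ typeSubmodule E 1 0 1 := by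
  have hdec := sum_antidiagonal_typeProjAt α
  have hanti : antidiagonal 1 = {((0 : ℕ), (1 : ℕ)), (1, 0)} := by decide
  rw [hanti, sum_insert (by decide), sum_singleton] at hdec
  dsimp only at hdec
  rw [← hdec, add_comm]
  exact Submodule.add_mem_sup ((isOfTypeAt_typeProjAt (p := 1) (q := 0) rfl α).mem_typeSubmodule)
    ((isOfTypeAt_typeProjAt (p := 0) (q := 1) rfl α).mem_typeSubmodule)

include Φ in
/-- **Mixed hard Lefschetz in degree one, injectivity**: for positive `(1,1)`-forms `θ_1, …, θ_n` on a torus of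
dimension `n + 1`, `Ω ∧ α = 0 ⇒ α = 0` for every `α ∈ H¹(X, ℂ)`. [cite: DinhNguyen2006, §1 Theorem B and §2 Prop. 2.1 (a) (arXiv PDF pp. 4–5)]
[cite: Timorin1998, Main Theorem and Corollary 2] -/
theorem wedgeFamily_wedge_injective_degreeOne {n : ℕ} (e : Fin (2 * (n + 1)) ≃ ι)
    {θ : Fin n → E [⋀^Fin 2]→L[ℝ] ℝ} (h11 : ∀ m (x y : E), θ m ![I • x, I • y] = θ m ![x, y])
    (hpos : ∀ m (v : E), v ≠ 0 → 0 < θ m ![I • v, v]) :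
    Function.Injective fun α : E [⋀^Fin 1]→L[ℝ] ℂ ↦ (wedgeFamily n fun m ↦ ofRealForm (-(θ m))).wedge α := by
  set L : (E [⋀^Fin 1]→L[ℝ] ℂ) →ₗ[ℂ] (E [⋀^Fin (2 * n + 1)]→L[ℝ] ℂ) :=
    { toFun := fun α ↦ (wedgeFamily n fun m ↦ ofRealForm (-(θ m))).wedge α
      map_add' := fun A B ↦ ContinuousAlternatingMap.wedge_add_right _ _ _
      map_smul' := fun c A ↦ wedge_smul_right_complex c _ _ } with hL
  change Function.Injective L
  rw [injective_iff_map_eq_zero]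
  intro α hα
  exact eq_zero_of_wedgeFamily_wedge_eq_zero_of_mem_sup Φ e one_ne_zero h11 hpos
    (mem_typeSubmodule_oneZero_sup_zeroOne α) hα

include Φ in
/-- **Mixed hard Lefschetz in degree one on a complex torus** (Dinh–Nguyên Thm. B for `k = 1`, Timorin's linear
case): `α ↦ ω_1 ∧ ⋯ ∧ ω_n ∧ α` is a bijection `H¹(X, ℂ) ⥲ H^{2n+1}(X, ℂ)` on a torus of dimension `n + 1`
(`dim = C(2n+2, 1) = C(2n+2, 2n+1)`). [cite: DinhNguyen2006, §1 Theorem B (arXiv PDF p. 4)]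
[cite: Timorin1998, Main Theorem and Corollary 2] [cite: Huybrechts2005, §3.3 Prop. 3.3.13]
[cite: Lange2023AbelianVarietiesComplex, §1.1.3 Cor. 1.1.19] -/
theorem wedgeFamily_wedge_bijective_degreeOne {n : ℕ} (e : Fin (2 * (n + 1)) ≃ ι)
    {θ : Fin n → E [⋀^Fin 2]→L[ℝ] ℝ} (h11 : ∀ m (x y : E), θ m ![I • x, I • y] = θ m ![x, y])
    (hpos : ∀ m (v : E), v ≠ 0 → 0 < θ m ![I • v, v]) :
    Function.Bijective fun α : E [⋀^Fin 1]→L[ℝ] ℂ ↦ (wedgeFamily n fun m ↦ ofRealForm (-(θ m))).wedge α := by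
  haveI := finiteDimensional_complex Φ
  haveI := finiteDimensional_complexForms Φ e (k := 1) (by omega)
  haveI := finiteDimensional_complexForms Φ e (k := 2 * n + 1) (by omega)
  have hg : finrank ℂ E = n + 1 := finrank_eq_of_finTwoMulEquiv Φ e
  set L : (E [⋀^Fin 1]→L[ℝ] ℂ) →ₗ[ℂ] (E [⋀^Fin (2 * n + 1)]→L[ℝ] ℂ) :=
    { toFun := fun α ↦ (wedgeFamily n fun m ↦ ofRealForm (-(θ m))).wedge α
      map_add' := fun A B ↦ ContinuousAlternatingMap.wedge_add_right _ _ _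
      map_smul' := fun c A ↦ wedge_smul_right_complex c _ _ } with hL
  have hinj : Function.Injective L := wedgeFamily_wedge_injective_degreeOne Φ e h11 hpos
  refine ⟨hinj, ?_⟩
  change Function.Surjective L
  refine (LinearMap.injective_iff_surjective_of_finrank_eq_finrank ?_).1 hinj
  rw [finrank_alt_real_complex E 1, finrank_alt_real_complex E (2 * n + 1), hg]
  exact Nat.choose_symm_of_eq_add (by ring)

include Φ in
/-- **Every class of `H^{2n+1}(X, ℂ)` is `Ω ∧ α` for a unique `α ∈ H¹(X, ℂ)`.** [cite: DinhNguyen2006, §1 Theorem B (arXiv PDF p. 4)] -/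
theorem existsUnique_wedgeFamily_wedge_eq_degreeOne {n : ℕ} (e : Fin (2 * (n + 1)) ≃ ι)
    {θ : Fin n → E [⋀^Fin 2]→L[ℝ] ℝ} (h11 : ∀ m (x y : E), θ m ![I • x, I • y] = θ m ![x, y])
    (hpos : ∀ m (v : E), v ≠ 0 → 0 < θ m ![I • v, v]) (C : E [⋀^Fin (2 * n + 1)]→L[ℝ] ℂ) :
    ∃! α : E [⋀^Fin 1]→L[ℝ] ℂ, (wedgeFamily n fun m ↦ ofRealForm (-(θ m))).wedge α = C :=
  (wedgeFamily_wedge_bijective_degreeOne Φ e h11 hpos).existsUnique C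

include Φ in
/-- **Real degree-one classes**: `Ω ∧ α_ℂ = 0` for `α ∈ H¹(X, ℝ)` forces `α = 0`. [cite: DinhNguyen2006, §1 Theorem B (arXiv PDF p. 4)] -/
theorem eq_zero_of_wedgeFamily_wedge_ofRealForm_eq_zero_degreeOne {n : ℕ} (e : Fin (2 * (n + 1)) ≃ ι)
    {θ : Fin n → E [⋀^Fin 2]→L[ℝ] ℝ} (h11 : ∀ m (x y : E), θ m ![I • x, I • y] = θ m ![x, y])
    (hpos : ∀ m (v : E), v ≠ 0 → 0 < θ m ![I • v, v]) {α : E [⋀^Fin 1]→L[ℝ] ℝ}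
    (h : (wedgeFamily n fun m ↦ ofRealForm (-(θ m))).wedge (ofRealForm α) = 0) : α = 0 :=
  ofRealForm_injective (by
    rw [ofRealForm_zero]
    exact wedgeFamily_wedge_injective_degreeOne Φ e h11 hpos (by simp only [h, ContinuousAlternatingMap.wedge_zero]))

include Φ in
/-- **The `(1,0)` and `(0,1)` pieces: `Ω ∧ · : H^{1,0}(X) ⥲ H^{n+1, n}(X)` and `H^{0,1}(X) ⥲ H^{n, n+1}(X)`** on a torus of
dimension `n + 1` (`dim = n + 1` on both sides). [cite: DinhNguyen2006, §2 Prop. 2.1 (a) (arXiv PDF p. 5)] -/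
theorem wedgeFamily_wedge_bijective_oneZero_zeroOne {n : ℕ} (e : Fin (2 * (n + 1)) ≃ ι)
    {θ : Fin n → E [⋀^Fin 2]→L[ℝ] ℝ} (h11 : ∀ m (x y : E), θ m ![I • x, I • y] = θ m ![x, y])
    (hpos : ∀ m (v : E), v ≠ 0 → 0 < θ m ![I • v, v]) :
    Function.Bijective (fun B : typeSubmodule E 1 1 0 ↦
        (⟨(wedgeFamily n fun m ↦ ofRealForm (-(θ m))).wedge B,
          wedgeFamily_wedge_mem_typeSubmodule' h11 rfl B.2⟩ : typeSubmodule E (2 * n + 1) (n + 1) (n + 0))) ∧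
      Function.Bijective (fun B : typeSubmodule E 1 0 1 ↦
        (⟨(wedgeFamily n fun m ↦ ofRealForm (-(θ m))).wedge B,
          wedgeFamily_wedge_mem_typeSubmodule' h11 (zero_add 1) B.2⟩ : typeSubmodule E (2 * n + 1) (n + 0) (n + 1))) :=
  ⟨wedgeFamily_wedge_bijective_pZero Φ e h11 hpos, wedgeFamily_wedge_bijective_zeroP Φ e h11 hpos⟩

end DegreeOne

/-! ## §4 Abelian varieties: `Ω = c₁(L_1) ∧ ⋯ ∧ c₁(L_n)` for polarisations `L_m` -/

section RiemannForm

variable {ι : Type*} [Fintype ι] [DecidableEq ι] {E : Type*} [NormedAddCommGroup E] [NormedSpace ℂ E]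
  (Φ : (ι → ℝ) ≃L[ℝ] E)

/-- **Hard Lefschetz on `H^{p,0}` for polarisations**: `c₁(L_1) ∧ ⋯ ∧ c₁(L_n) ∧ · : H^{p,0}(X) ⥲ H^{n+p, n}(X)` on an abelian
variety of dimension `n + p`. [cite: DinhNguyen2006, §2 Prop. 2.1 (a) (arXiv PDF p. 5)] [cite: Lange2023AbelianVarietiesComplex, §5.1.2 (p. 244)] -/
theorem IsRiemannForm.wedgeFamily_wedge_bijective_pZero {n p : ℕ} (e : Fin (2 * (n + p)) ≃ ι)
    {θ : Fin n → E [⋀^Fin 2]→L[ℝ] ℝ} (hθ : ∀ m, IsRiemannForm Φ (θ m)) :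
    Function.Bijective fun B : typeSubmodule E p p 0 ↦
      (⟨(wedgeFamily n fun m ↦ ofRealForm (-(θ m))).wedge B,
        wedgeFamily_wedge_mem_typeSubmodule' (fun m ↦ (hθ m).1) rfl B.2⟩ :
          typeSubmodule E (2 * n + p) (n + p) (n + 0)) :=
  ComplexTorus.wedgeFamily_wedge_bijective_pZero Φ e (fun m ↦ (hθ m).1) (fun m ↦ (hθ m).2.2)

/-- **Mixed hard Lefschetz in degree one for polarisations**: `c₁(L_1) ∧ ⋯ ∧ c₁(L_n) ∧ · : H¹(X, ℂ) ⥲ H^{2n+1}(X, ℂ)` on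
an abelian variety of dimension `n + 1`. [cite: DinhNguyen2006, §1 Theorem B (arXiv PDF p. 4)]
[cite: Lange2023AbelianVarietiesComplex, §5.1.2 (p. 244)] -/
theorem IsRiemannForm.wedgeFamily_wedge_bijective_degreeOne {n : ℕ} (e : Fin (2 * (n + 1)) ≃ ι)
    {θ : Fin n → E [⋀^Fin 2]→L[ℝ] ℝ} (hθ : ∀ m, IsRiemannForm Φ (θ m)) :
    Function.Bijective fun α : E [⋀^Fin 1]→L[ℝ] ℂ ↦ (wedgeFamily n fun m ↦ ofRealForm (-(θ m))).wedge α :=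
  ComplexTorus.wedgeFamily_wedge_bijective_degreeOne Φ e (fun m ↦ (hθ m).1) (fun m ↦ (hθ m).2.2)

end RiemannForm

end ComplexTorus

end Literature.Geometry.Kaehler

end
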